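import Summits.BirchSwinnertonDyer.BirchSwinnertonDyer.Theorems.ClassRecordThreeCornerAtThreeShimuraFamilyLevelData
import Summits.BirchSwinnertonDyer.BirchSwinnertonDyer.Theorems.ErratumRoadFiveShimuraKolyvaginOrderBoundInertCarrierGlue
import Summits.BirchSwinnertonDyer.Rank1Residual.X11b.KolyvaginTauEigenConcrete
import HarnessLib

/-!
# Gross 1991 Prop. 5.4 (the SIGN under complex conjugation: `τ P_m = ε_m P_m + p^M B`, `τ_* c_M(m) = ε_m c_M(m)`, `ε_m = ε·(−1)^{#primes}`)
# for the classes of a family of GENERALISED Kolyvagin data from the labels (B3) (Gross 5.3 ∕ Bertolini–Darmon 2.6 shape) and (B4) —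
# bsd-jet's `Rank1ResidualJetKolyvaginClassSign` RE-KEYED on `JET.KolyvaginFamilyData`, label-consuming (cell `bsd-stepL`, seat
# `bsd-stepL-corner3-p2` g8 = WIDTH-LEVER lane B; `--supports stmt-BirchSwinnertonDyer-21420 --as helper`)

WHY (PORT MAP (P2) §2 (v) «h53D twin = label (B3)»; RULING 47 (4)). The sign input of the walk ∕ swap (`hκt`'s sign, `hκsign`, the `eb` bookkeeping)
is, on `X₀(N)`, bsd-jet's `pointsMap_derivedPoint_concrete_of_prop53_zhang` ∕ `conjAct_kolyvaginClass_eq_sign_smul_zhang`, whose inputs McCallum (4)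
and `Tr_ℓ y_m ∈ p^M E(K_m)` come from (β2) PROVED for Heegner data. For the labelled CM family of `X_{N⁺,N⁻}` these are the LABELS (B4) (trace) and
(B3) (conjugation), so the twin is not a mechanical re-key. THIS FILE proves, for a family `d : (m ∣ n) → KolyvaginFamilyData W K ι m` over a
square-free top level on Kolyvagin primes of Gross depth `M ≥ 1`, from (B4) in datum form, (B3) in datum form
(`∀ τm conj, ∃ σ′ ∈ 𝒢_m, τm y(m) − ε σ′ y(m)` torsion) and admissibility:
* `pointsMap_derivedPoint_familyData_of_labels` — `τ̃ · P(m) = ε_m P(m) + p^M B`, `B ∈ E(K[m])` (Gross 5.4 (1));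
* `conjAct_kolyvaginClass_familyData_eq_sign_smul` — `τ_* c_M(m) = ε_m • c_M(m)` in `H¹(K, E[p^M])` (Gross 5.4 (2)).
Proof = bsd-jet's, on the level data of `ShimuraWalk.exists_levelData_familyData` (p599103): McCallum (4) from (B4) by the abstract
`KolyvaginEuler.smul_kolyvaginPoint_sub_mem`; `τ_m`, the dihedral `T` and the lift glue from x11b3 ∕ shim-p1 (`RingClassConj.exists_conj_algEquiv`,
`KolyvaginConj.exists_addMonoidHom_map_smul_eq_inv_smul`, `exists_mem_ringClassGal_apply_ringHom_eq`, `pointsMap_map_ringHom_eq`); Prop. 5.4 (1)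
abstract = `KolyvaginEuler.conj_kolyvaginPoint_sub_mem`; (2) from (1) = Literature `conjAct_kolyvaginClass_eq_smul`.
HONEST FRAMING: theorems only (no definition, no named fact, no `sorry`); CONDITIONAL on the displayed labels; nothing about any Heegner ∕ CM point is
constructed; no stub closes; BSD is not proved by any of this; T7. Credit: bsd-jet pv (sign file), x11b3 (TauEigen, Conj), shim-p1 g8 (lift glue).
References: [cite: GrossLMS1991, §5 Prop. 5.4 (1)(2) and proof, Prop. 5.3, §3 (τστ⁻¹ = σ⁻¹), (3.3), §4 (4.1)–(4.2), Lemma 4.3]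
[cite: McCallumLMS1991, §4 (4)–(6)] [cite: BertoliniDarmon1996, Prop. 2.6] [cite: Jetchev2008, §4.1.3 (ε(c))].
presearch: not applicable (re-keying of a tree theorem on labels); `lean search 'familyData_of_labels|familyData_eq_sign'` → none.
-/

set_option autoImplicit false
set_option linter.dupNamespace false

noncomputable section

open scoped Classical

namespace Summit.BirchSwinnertonDyer.BirchSwinnertonDyer.Theorems.ShimuraWalk

open WeierstrassCurve Field NumberField IsDedekindDomain Finset
  Literature.NumberTheory.EllipticCurves Literature.NumberTheory.GaloisRepresentations
  Literature.NumberTheory.EllipticCurves.KolyvaginCocycle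
  Literature.NumberTheory.EllipticCurves.KolyvaginEuler
  Literature.NumberTheory.EllipticCurves.RingClassField
  Literature.NumberTheory.EllipticCurves.ModularForms
  Summit.BirchSwinnertonDyer.Rank1Residual.X11b
  Summit.BirchSwinnertonDyer.Rank1Residual.JET
  Summit.BirchSwinnertonDyer.BirchSwinnertonDyer.Theorems

variable {K : Type} [Field K] [NumberField K] {W : WeierstrassCurve ℚ}

set_option maxHeartbeats 800000 in
/-- **Gross 1991 Prop. 5.4 (1) for a family of generalised Kolyvagin data, from (B3) + (B4)**: `τ̃ P(m) = ε_m P(m) + p^M B` with `B ∈ E(K[m])`,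
`ε_m = ε · (−1)^{#primes of m}`, at every `m ∣ n`. See the module docstring. [cite: GrossLMS1991, §5 Prop. 5.4 (1), Prop. 5.3, §4 (4.1), Lemma 4.3]
[cite: McCallumLMS1991, §4 (4)–(5)] [cite: BertoliniDarmon1996, Prop. 2.6] -/
theorem pointsMap_derivedPoint_familyData_of_labels {N : ℕ} [NeZero N] [W.IsElliptic] [W.IsGloballyMinimal]
    (hK : IsImaginaryQuadratic K) (ι : K →+* ℂ)
    {p M : ℕ} (hp : p.Prime) (hM : 1 ≤ M) (Dt : ModularParametrizationData W N)
    {n : ℕ} (hn : Squarefree n)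
    (hKol : ∀ q ∈ n.primeFactors, IsKolyvaginPrime N W K p q ∧ FrobEqFrobInfty W K (p ^ M) q)
    (d : (m : ℕ) → m ∣ n → KolyvaginFamilyData W K ι m)
    {c : K ≃ₐ[ℚ] K} (hc : c ≠ 1) {τ : AlgebraicClosure K ≃+* AlgebraicClosure K}
    (hτ : IsLiftOfAut c τ) (ε : ℤ)
    (hB4d : ∀ (m : ℕ) (hm : m ∣ n), ∀ (ℓ : ℕ) (hℓ : ℓ ∈ m.primeFactors)
      (hle : ringClassField K ι (m / ℓ) ≤ ringClassField K ι m),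
      ∑ i ∈ Finset.range (ℓ + 1), pointGalHom W (ringClassField K ι m) ((d m hm).σ ℓ ^ i) (d m hm).y =
        W.frobeniusTrace ℓ • WeierstrassCurve.Affine.Point.map (W' := W)
          ((RingClassField.inclusion ι hle).restrictScalars ℚ)
          (d (m / ℓ) ((Nat.div_dvd_of_dvd (Nat.dvd_of_mem_primeFactors hℓ)).trans hm)).y)
    (hB3d : ∀ (m : ℕ) (hm : m ∣ n) (τm : ringClassField K ι m ≃ₐ[ℚ] ringClassField K ι m),
      (∀ x : ringClassField K ι m, ((τm x : ringClassField K ι m) : ℂ) = starRingEnd ℂ x) →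
      ∃ σ' ∈ ringClassGal ι m, IsOfFinAddOrder
        (pointGalHom W (ringClassField K ι m) τm (d m hm).y -
          ε • pointGalHom W (ringClassField K ι m) σ' (d m hm).y))
    (hA : ∀ (m : ℕ) (hm : m ∣ n),
      IsAdmissible (absoluteGaloisGroup K) (d m hm).pointsSubgroup ((p ^ M : ℕ) : ℤ)) :
    ∀ (m : ℕ) (hm : m ∣ n), ∃ B ∈ (d m hm).pointsSubgroup,
      hτ.pointsMap W ((d m hm).toGeomPoints (d m hm).derivedPoint) =
        (ε * (-1) ^ m.primeFactors.card) • (d m hm).toGeomPoints (d m hm).derivedPoint +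
          ((p ^ M : ℕ) : ℤ) • B := by
  intro m hm
  haveI : Fact p.Prime := ⟨hp⟩
  have hn0 : n ≠ 0 := Squarefree.ne_zero hn
  have hm0 : m ≠ 0 := ne_zero_of_dvd_ne_zero hn0 hm
  have hinert : ∀ q ∈ n.primeFactors, (Ideal.span {(q : 𝓞 K)}).IsPrime :=
    fun q hq ↦ (hKol q hq).1.2.2.2.2.1
  -- the structures of the level-data package and THE SEAM
  letI hcg : ∀ k, CommGroup (ringClassGal ι k) := fun k ↦
    { (inferInstance : Group (ringClassGal ι k)) with
      mul_comm := fun a b ↦ (KolyvaginH44.isMulCommutative_ringClassGal' hK ι k).is_comm.comm a b }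
  letI act : ∀ k, DistribMulAction (ringClassGal ι k)
      ((W.baseChange (ringClassField K ι k)).toAffine.Point) := fun k ↦
    DistribMulAction.compHom _ ((pointGalHom W (ringClassField K ι k)).comp (ringClassGal ι k).subtype)
  choose σ H hF f y π j e hord hj hπρ hfsec hHρ hdict hjunk using
    fun k ↦ exists_levelData_familyData (W := W) hK ι hn hinert d k
  letI hft : ∀ k, Fintype (ringClassGal ι k ⧸ H k) := hF
  have hsmul : ∀ (k) (g : ringClassGal ι k) (Q : (W.baseChange (ringClassField K ι k)).toAffine.Point),
      g • Q = pointGalHom W (ringClassField K ι k)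
        (g : ringClassField K ι k ≃ₐ[ℚ] ringClassField K ι k) Q := fun _ _ _ ↦ rfl
  have hmul : ∀ (a b : ringClassField K ι m ≃ₐ[ℚ] ringClassField K ι m)
      (Q : (W.baseChange (ringClassField K ι m)).toAffine.Point),
      pointGalHom W (ringClassField K ι m) (a * b) Q =
        pointGalHom W (ringClassField K ι m) a (pointGalHom W (ringClassField K ι m) b Q) :=
    fun a b Q ↦ by rw [map_mul]; rfl
  set ρ : ∀ k, ringClassGal ι k →* (ringClassField K ι k ≃ₐ[ℚ] ringClassField K ι k) :=
    fun k ↦ (ringClassGal ι k).subtype with hρdef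
  have hρ : ∀ k, Function.Injective (ρ k) := fun k ↦ (ringClassGal ι k).subtype_injective
  obtain ⟨hjm, hym, hσm, hfS, hem, hPm⟩ := hdict m hm
  have hle : ∀ {ℓ : ℕ}, ℓ ∈ m.primeFactors → ringClassField K ι (m / ℓ) ≤ ringClassField K ι m :=
    fun hℓ ↦ ringClassField_mono hK ι (Nat.div_dvd_of_dvd (Nat.dvd_of_mem_primeFactors hℓ)) hm0
  -- the Euler hypotheses at level `m`: `hgen`, `hdvd`, `htr` (from (B4) + (3.3))
  have hgen : H m ≤ Subgroup.closure (σ m '' (m.primeFactors : Set ℕ)) :=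
    le_closure_of_map_zpowers hK ι (hn.squarefree_of_dvd hm) (σ m) (H m) (ρ m) (hρ m)
      (fun q hq ↦ by
        rw [MonoidHom.map_zpowers]
        change Subgroup.zpowers (σ m q : ringClassField K ι m ≃ₐ[ℚ] ringClassField K ι m) = _
        rw [hσm q hq]; exact (d m hm).zpowers_σ q hq)
      (hHρ m)
  have hdvd : ∀ ℓ ∈ m.primeFactors, ((p ^ M : ℕ) : ℤ) ∣ ((ℓ + 1 : ℕ) : ℤ) := by
    intro ℓ hℓ
    obtain ⟨hℓK, hℓM⟩ := hKol ℓ (Nat.primeFactors_mono hm hn0 hℓ)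
    exact (IsKolyvaginPrime.pow_dvd_add_one W hp hℓK hM hℓM).1
  have htr : ∀ ℓ ∈ m.primeFactors,
      grAct ((W.baseChange (ringClassField K ι m)).toAffine.Point) (traceElt (σ m ℓ) ℓ) (y m) ∈
        zsmulRange ((W.baseChange (ringClassField K ι m)).toAffine.Point) ((p ^ M : ℕ) : ℤ) := by
    intro ℓ hℓ
    have hrel : grAct ((W.baseChange (ringClassField K ι m)).toAffine.Point) (traceElt (σ m ℓ) ℓ) (y m) =
        W.frobeniusTrace ℓ • WeierstrassCurve.Affine.Point.map (W' := W)
          ((RingClassField.inclusion ι (hle hℓ)).restrictScalars ℚ)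
          (d (m / ℓ) ((Nat.div_dvd_of_dvd (Nat.dvd_of_mem_primeFactors hℓ)).trans hm)).y := by
      rw [grAct_traceElt, hym, ← hB4d m hm ℓ hℓ (hle hℓ)]
      refine Finset.sum_congr rfl fun i _ ↦ ?_
      rw [hsmul, Subgroup.coe_pow, hσm ℓ hℓ]
    exact grAct_traceElt_mem_of_eq_smul hrel
      (pow_dvd_frobeniusTrace_of_kolyvaginPrime (K := K) Dt hp hM (hKol ℓ (Nat.primeFactors_mono hm hn0 hℓ)).1
        (hKol ℓ (Nat.primeFactors_mono hm hn0 hℓ)).2)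
  -- McCallum's (4): `γ P(m) − P(m) ∈ p^M E(K[m])` (abstract Euler lemma, from (B4))
  have h4 : ∀ γ : ringClassGal ι m,
      γ • kolyvaginPoint (σ m) m.primeFactors (f m) (y m) -
          kolyvaginPoint (σ m) m.primeFactors (f m) (y m) ∈
        zsmulRange ((W.baseChange (ringClassField K ι m)).toAffine.Point) ((p ^ M : ℕ) : ℤ) :=
    fun γ ↦ smul_kolyvaginPoint_sub_mem (hfsec m) hgen (hord m) hdvd htr γ
  -- the conjugation automorphism `τ_m` of `K[m]` and the restriction `τ|K[m] = τ_m · h`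
  obtain ⟨τm, hτm⟩ := RingClassConj.exists_conj_algEquiv hK ι hm0
  have hτm𝒢 : τm ∉ ringClassGal ι m := RingClassConj.conj_not_mem_ringClassGal hτm hK
  obtain ⟨h, hh𝒢, hres⟩ :=
    exists_mem_ringClassGal_apply_ringHom_eq hK ι hm0 (d m hm).emb (d m hm).emb_apply hc hτ hτm
  -- no `p^M`-torsion in `E(K[m])` (Lemma 4.3, from `hA` along the injective `toGeomPoints`)
  have hX : ∀ a : (W.baseChange (ringClassField K ι m)).toAffine.Point,
      ((p ^ M : ℕ) : ℤ) • a = 0 → a = 0 := by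
    intro a ha
    have h0 : (d m hm).toGeomPoints a = 0 := by
      refine (hA m hm).eq_zero_of_zsmul ⟨a, rfl⟩ ?_
      rw [← map_zsmul (d m hm).toGeomPoints, ha, map_zero]
    have h0' : WeierstrassCurve.Affine.Point.map (W' := W) (d m hm).emb.toRatAlgHom a =
        WeierstrassCurve.Affine.Point.map (W' := W) (d m hm).emb.toRatAlgHom 0 := by
      rw [map_zero]
      exact h0
    exact WeierstrassCurve.Affine.Point.map_injective (W' := W) (d m hm).emb.toRatAlgHom h0'
  -- `T := τ_m` on `E(K[m])` with the dihedral law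
  obtain ⟨T, hTapp', hT⟩ := KolyvaginConj.exists_addMonoidHom_map_smul_eq_inv_smul hK hm0 W (ρ m)
    (fun g ↦ g.2) (AddEquiv.refl _) (fun g a ↦ hsmul m g a) hτm𝒢
  have hTapp : ∀ P, T P = pointGalHom W (ringClassField K ι m) τm P := fun P ↦ hTapp' P
  -- (B3) ⟹ `hτy` in `p^M E(K[m])` currency
  obtain ⟨σ', hσ'𝒢, hford⟩ := hB3d m hm τm hτm
  have hτy : T (y m) - ε • (⟨σ', hσ'𝒢⟩ : ringClassGal ι m) • y m ∈
      zsmulRange ((W.baseChange (ringClassField K ι m)).toAffine.Point) ((p ^ M : ℕ) : ℤ) := by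
    rw [hsmul, hTapp, hym]
    exact KolyvaginTauEigen.mem_zsmulRange_of_isOfFinAddOrder hp hM hX hford
  -- Prop. 5.4 (1), abstract
  have h54 : T (kolyvaginPoint (σ m) m.primeFactors (f m) (y m)) -
        (ε * (-1) ^ m.primeFactors.card) • kolyvaginPoint (σ m) m.primeFactors (f m) (y m) ∈
      zsmulRange ((W.baseChange (ringClassField K ι m)).toAffine.Point) ((p ^ M : ℕ) : ℤ) :=
    conj_kolyvaginPoint_sub_mem (hfsec m) hgen (fun ℓ hℓ ↦ hord m ℓ hℓ) hdvd htr T hT hτy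
  -- assemble: `τ̃ · P(m) = (τ_m h) P(m) = τ_m (P(m) + p^M a₁) = ε_m P(m) + p^M (a₂ + τ_m a₁)`
  obtain ⟨a₁, ha₁⟩ := h4 ⟨h, hh𝒢⟩
  obtain ⟨a₂, ha₂⟩ := h54
  change ((p ^ M : ℕ) : ℤ) • a₁ =
    pointGalHom W (ringClassField K ι m) h (kolyvaginPoint (σ m) m.primeFactors (f m) (y m)) -
      kolyvaginPoint (σ m) m.primeFactors (f m) (y m) at ha₁
  change ((p ^ M : ℕ) : ℤ) • a₂ = _ at ha₂
  rw [hPm] at ha₁ ha₂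
  have hg : ∀ x, τ ((d m hm).emb x) = (d m hm).emb ((τm * h) x) := fun x ↦ by
    rw [AlgEquiv.mul_apply]; exact hres x
  have hmap := pointsMap_map_ringHom_eq (W := W) (d m hm).emb (d m hm).toGeomPoints rfl hτ hg (d m hm).derivedPoint
  refine ⟨(d m hm).toGeomPoints (a₂ + T a₁), ⟨a₂ + T a₁, rfl⟩, ?_⟩
  have hstep : pointGalHom W (ringClassField K ι m) (τm * h) (d m hm).derivedPoint =
      (ε * (-1) ^ m.primeFactors.card) • (d m hm).derivedPoint + ((p ^ M : ℕ) : ℤ) • (a₂ + T a₁) := by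
    have h1 : pointGalHom W (ringClassField K ι m) h (d m hm).derivedPoint =
        (d m hm).derivedPoint + ((p ^ M : ℕ) : ℤ) • a₁ := by
      rw [ha₁]; abel
    have h2 : T (d m hm).derivedPoint =
        (ε * (-1) ^ m.primeFactors.card) • (d m hm).derivedPoint + ((p ^ M : ℕ) : ℤ) • a₂ := by
      rw [ha₂]; abel
    rw [hmul, h1, ← hTapp, map_add, map_zsmul, h2, smul_add]
    abel
  rw [hmap, hstep, map_add, map_zsmul, map_zsmul]

/-- **Gross 1991 Prop. 5.4 (2) for a family of generalised Kolyvagin data, from (B3) + (B4)**: `τ_* c_M(m) = ε_m • c_M(m)` in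
`H¹(K, E[p^M])` (`conjAct W c (p^M)`), at every `m ∣ n`. On the admissible∕invariant branch this is the Literature functoriality
`conjAct_kolyvaginClass_eq_smul` fed with (1); on the junk branch both sides vanish. [cite: GrossLMS1991, §5 Prop. 5.4 (2)] [cite: McCallumLMS1991, §4 (4.2), (6)] -/
theorem conjAct_kolyvaginClass_familyData_eq_sign_smul {N : ℕ} [NeZero N] [W.IsElliptic] [W.IsGloballyMinimal]
    (hK : IsImaginaryQuadratic K) (ι : K →+* ℂ)
    {p M : ℕ} (hp : p.Prime) (hM : 1 ≤ M) (Dt : ModularParametrizationData W N)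
    {n : ℕ} (hn : Squarefree n)
    (hKol : ∀ q ∈ n.primeFactors, IsKolyvaginPrime N W K p q ∧ FrobEqFrobInfty W K (p ^ M) q)
    (d : (m : ℕ) → m ∣ n → KolyvaginFamilyData W K ι m)
    {c : K ≃ₐ[ℚ] K} (hc : c ≠ 1) (ε : ℤ)
    (hB4d : ∀ (m : ℕ) (hm : m ∣ n), ∀ (ℓ : ℕ) (hℓ : ℓ ∈ m.primeFactors)
      (hle : ringClassField K ι (m / ℓ) ≤ ringClassField K ι m),
      ∑ i ∈ Finset.range (ℓ + 1), pointGalHom W (ringClassField K ι m) ((d m hm).σ ℓ ^ i) (d m hm).y =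
        W.frobeniusTrace ℓ • WeierstrassCurve.Affine.Point.map (W' := W)
          ((RingClassField.inclusion ι hle).restrictScalars ℚ)
          (d (m / ℓ) ((Nat.div_dvd_of_dvd (Nat.dvd_of_mem_primeFactors hℓ)).trans hm)).y)
    (hB3d : ∀ (m : ℕ) (hm : m ∣ n) (τm : ringClassField K ι m ≃ₐ[ℚ] ringClassField K ι m),
      (∀ x : ringClassField K ι m, ((τm x : ringClassField K ι m) : ℂ) = starRingEnd ℂ x) →
      ∃ σ' ∈ ringClassGal ι m, IsOfFinAddOrder
        (pointGalHom W (ringClassField K ι m) τm (d m hm).y -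
          ε • pointGalHom W (ringClassField K ι m) σ' (d m hm).y))
    (hA : ∀ (m : ℕ) (hm : m ∣ n),
      IsAdmissible (absoluteGaloisGroup K) (d m hm).pointsSubgroup ((p ^ M : ℕ) : ℤ)) :
    ∀ (m : ℕ) (hm : m ∣ n),
      conjAct W c ((p ^ M : ℕ) : ℤ) ((d m hm).kolyvaginClass hp M) =
        (ε * (-1) ^ m.primeFactors.card) • (d m hm).kolyvaginClass hp M := by
  intro m hm
  have hm0 : m ≠ 0 := ne_zero_of_dvd_ne_zero hn.ne_zero hm
  rw [KolyvaginFamilyData.kolyvaginClass_def]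
  by_cases h0 : IsAdmissible (absoluteGaloisGroup K) (d m hm).pointsSubgroup ((p ^ M : ℕ) : ℤ) ∧
      (d m hm).toGeomPoints (d m hm).derivedPoint ∈
        invPoints (absoluteGaloisGroup K) (d m hm).pointsSubgroup ((p ^ M : ℕ) : ℤ)
  · rw [dif_pos h0]
    have hτ : IsLiftOfAut c (liftAut c) := isLiftOfAut_liftAut c
    obtain ⟨B, hB, hcong⟩ := pointsMap_derivedPoint_familyData_of_labels hK ι hp hM Dt hn hKol d hc hτ ε hB4d hB3d hA m hm
    -- `τ̃`-stability of `E(K[m]) ⊆ E(K̄)`: `τ̃ ∘ emb = emb ∘ (τ_m h)`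
    obtain ⟨τm, hτm⟩ := RingClassConj.exists_conj_algEquiv hK ι hm0
    obtain ⟨h, -, hres⟩ :=
      exists_mem_ringClassGal_apply_ringHom_eq hK ι hm0 (d m hm).emb (d m hm).emb_apply hc hτ hτm
    have hg : ∀ x, liftAut c ((d m hm).emb x) = (d m hm).emb ((τm * h) x) := fun x ↦ by
      rw [AlgEquiv.mul_apply]; exact hres x
    have hAτ : ∀ a ∈ (d m hm).pointsSubgroup, hτ.pointsMap W a ∈ (d m hm).pointsSubgroup := by
      rintro a ⟨a₀, rfl⟩
      exact ⟨pointGalHom W (ringClassField K ι m) (τm * h) a₀,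
        (pointsMap_map_ringHom_eq (W := W) (d m hm).emb (d m hm).toGeomPoints rfl hτ hg a₀).symm⟩
    exact conjAct_kolyvaginClass_eq_smul W hτ h0.1 hAτ h0.2 _ ⟨B, hB, hcong⟩
  · rw [dif_neg h0, map_zero, zsmul_zero]

end Summit.BirchSwinnertonDyer.BirchSwinnertonDyer.Theorems.ShimuraWalk

end
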